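import Mathlib.Topology.MetricSpace.Pseudo.Lemmas
import Mathlib.Topology.Order.IntermediateValue
import Mathlib.Analysis.Normed.Order.Lattice
import HarnessLib

/-!
# The distance to a far point along a short axis-parallel segment

Topic: infrastructure for the coned fence collar (`TautFoliationsCollarDisc.lean`,
`TautFoliationsRadialSquares.lean`). Along an axis-parallel segment of length `< R₀` all of
whose points are at (sup-metric) distance `≥ R₀` from a point `c₀`, the distance to `c₀` is
**constant and then strictly increasing, or strictly decreasing and then constant** (one of
the two pieces may be degenerate): in coordinates it is `u ↦ max |α + u| C`, and the segment is
too short to pass from `α + u < -C` to `α + u > C` while staying far from `c₀`. Hence the level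
of the collar disc, an affine function of this distance on the outer collar, is piecewise
strictly monotone or constant along the grid edges there, which makes its heights tame.

* `maxAbs_shape` (**proved**): the shape of `u ↦ max |α + u| C` on `[0, len]` under the
  hypotheses `len < R₀ ≤ max |α + u| C`.
* `dist_horizontal_shape`, `dist_vertical_shape` (**proved**): the same for the distance to
  `c₀` along horizontal and vertical segments.

All statements are [folklore].
-/

noncomputable section

open Set Function Metric

namespace Literature.Topology.FourManifolds

namespace CollarRadius

/-- **Shape of a piecewise function: constant then strictly increasing, or strictly decreasing
then constant** on `[0, len]`, with break point `u⋆`. [folklore] -/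
def ConstMonoShape (f : ℝ → ℝ) (len : ℝ) : Prop :=
  ∃ u ∈ Icc 0 len, ((∀ v ∈ Icc 0 u, f v = f 0) ∧ StrictMonoOn f (Icc u len)) ∨
    (StrictAntiOn f (Icc 0 u) ∧ ∀ v ∈ Icc u len, f v = f len)

/-- **The shape of `u ↦ max |α + u| C` on a short interval far from the origin.** [folklore] -/
theorem maxAbs_shape {α C len R₀ : ℝ} (hC : 0 ≤ C) (hlen : 0 ≤ len) (hR : len < R₀)
    (hfar : ∀ u ∈ Icc 0 len, R₀ ≤ max |α + u| C) : ConstMonoShape (fun u ↦ max |α + u| C) len := by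
  have hR₀ : 0 < R₀ := lt_of_le_of_lt hlen hR
  by_cases hCR : C < R₀
  · -- `|α + u| ≥ R₀ > C` throughout: no sign change, the max is `|α + u|`, affine
    have habs : ∀ u ∈ Icc 0 len, R₀ ≤ |α + u| := fun u hu ↦ by
      have h := hfar u hu
      rcases le_max_iff.1 h with h | h
      · exact h
      · exact absurd h (not_le.2 hCR)
    have hmax : ∀ u ∈ Icc 0 len, max |α + u| C = |α + u| := fun u hu ↦
      max_eq_left (hCR.le.trans (habs u hu))
    -- sign of `α + u` is constant
    have hsign : (∀ u ∈ Icc 0 len, R₀ ≤ α + u) ∨ (∀ u ∈ Icc 0 len, α + u ≤ -R₀) := by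
      by_cases h0 : 0 ≤ α
      · left; intro u hu
        have h := habs u hu
        rw [abs_of_nonneg (by linarith [hu.1])] at h; exact h
      · right; intro u hu
        have h := habs u hu
        have h0' := habs 0 ⟨le_rfl, hlen⟩
        rw [add_zero, abs_of_neg (not_le.1 h0)] at h0'
        -- `α ≤ -R₀`, and `α + u ≤ α + len < -R₀ + R₀ = 0`
        have hneg : α + u < 0 := by linarith [hu.2]
        rw [abs_of_neg hneg] at h; linarith
    rcases hsign with h | h
    · -- increasing: break point `0`
      refine ⟨0, ⟨le_rfl, hlen⟩, Or.inl ⟨fun v hv ↦ by rw [le_antisymm hv.2 hv.1], fun a ha b hb hab ↦ ?_⟩⟩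
      simp only
      rw [hmax a ha, hmax b hb, abs_of_nonneg (by linarith [h a ha, h b hb]), abs_of_nonneg (by linarith [h a ha, h b hb])]
      linarith
    · -- decreasing: break point `len`
      refine ⟨len, ⟨hlen, le_rfl⟩, Or.inr ⟨fun a ha b hb hab ↦ ?_, fun v hv ↦ by rw [le_antisymm hv.2 hv.1]⟩⟩
      simp only
      rw [hmax a ha, hmax b hb, abs_of_nonpos (by linarith [h a ha, h b hb]), abs_of_nonpos (by linarith [h a ha, h b hb])]
      linarith [h a ha, h b hb]
  · -- `C ≥ R₀ > len`: the flat part `|α + u| ≤ C` is an interval containing an end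
    push Not at hCR
    have hmax_of_le : ∀ u, |α + u| ≤ C → max |α + u| C = C := fun u h ↦ max_eq_right h
    have hmax_of_ge : ∀ u, C ≤ |α + u| → max |α + u| C = |α + u| := fun u h ↦ max_eq_left h
    -- not both `α < -C` somewhere... : the two strict sides cannot both occur on `[0, len]`
    by_cases hpos : ∃ u ∈ Icc 0 len, C < α + u
    · -- then `α + v > -C` everywhere (width), the flat part is `[0, u⋆]` with `u⋆ = C - α` clamped
      obtain ⟨u₁, hu₁, hu₁C⟩ := hpos
      have hgt : ∀ v ∈ Icc 0 len, -C < α + v := fun v hv ↦ by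
        have : α + u₁ - (α + v) ≤ len := by linarith [hu₁.2, hv.1]
        linarith
      -- break point
      set us : ℝ := max 0 (C - α) with hus
      have husle : us ≤ len := max_le hlen (by linarith [hu₁.2])
      refine ⟨us, ⟨le_max_left _ _, husle⟩, Or.inl ⟨fun v hv ↦ ?_, fun a ha b hb hab ↦ ?_⟩⟩
      · -- flat on `[0, us]`: there `α + v ≤ C`
        by_cases hflat : C - α ≤ 0
        · -- `us = 0`
          have : us = 0 := max_eq_left hflat
          rw [this] at hv; rw [le_antisymm hv.2 hv.1]
        · push Not at hflat
          have husC : us = C - α := max_eq_right hflat.le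
          have h1 : |α + v| ≤ C := abs_le.2 ⟨by linarith [hgt v ⟨hv.1, hv.2.trans husle⟩], by rw [husC] at hv; linarith [hv.2]⟩
          have h0 : |α + 0| ≤ C := abs_le.2 ⟨by linarith [hgt 0 ⟨le_rfl, hlen⟩], by linarith⟩
          simp only
          rw [hmax_of_le v h1, hmax_of_le 0 h0]
      · -- strictly increasing on `[us, len]`: there `α + v ≥ C ≥ 0`
        simp only
        have hage : C ≤ α + a := by have := le_max_right 0 (C - α); linarith [ha.1]
        have hbge : C ≤ α + b := by have := le_max_right 0 (C - α); linarith [hb.1]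
        rw [hmax_of_ge a (hage.trans (le_abs_self _)), hmax_of_ge b (hbge.trans (le_abs_self _)),
          abs_of_nonneg (hC.trans hage), abs_of_nonneg (hC.trans hbge)]
        linarith
    · push Not at hpos
      -- `α + u ≤ C` on the whole interval
      by_cases hneg : ∃ u ∈ Icc 0 len, α + u < -C
      · -- strictly decreasing then flat, break point `u⋆ = -C - α` clamped
        obtain ⟨u₁, hu₁, hu₁C⟩ := hneg
        set us : ℝ := min len (-C - α) with hus
        have hus0 : 0 ≤ us := le_min hlen (by linarith [hu₁.1])
        refine ⟨us, ⟨hus0, min_le_left _ _⟩, Or.inr ⟨fun a ha b hb hab ↦ ?_, fun v hv ↦ ?_⟩⟩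
        · -- decreasing on `[0, us]`: there `α + v ≤ -C ≤ 0`
          simp only
          have hale : α + a ≤ -C := by have := min_le_right len (-C - α); linarith [ha.2]
          have hble : α + b ≤ -C := by have := min_le_right len (-C - α); linarith [hb.2]
          rw [hmax_of_ge a (by rw [abs_of_nonpos (by linarith)]; linarith),
            hmax_of_ge b (by rw [abs_of_nonpos (by linarith)]; linarith),
            abs_of_nonpos (by linarith), abs_of_nonpos (by linarith)]
          linarith
        · -- flat on `[us, len]`
          by_cases hflat : len ≤ -C - α
          · have : us = len := min_eq_left hflat
            rw [this] at hv; rw [le_antisymm hv.1 hv.2]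
          · push Not at hflat
            have husC : us = -C - α := min_eq_right hflat.le
            have h1 : |α + v| ≤ C := abs_le.2 ⟨by rw [husC] at hv; linarith [hv.1], hpos v ⟨hus0.trans hv.1, hv.2⟩⟩
            have h2 : |α + len| ≤ C := abs_le.2 ⟨by linarith, hpos len ⟨hlen, le_rfl⟩⟩
            simp only
            rw [hmax_of_le v h1, hmax_of_le len h2]
      · -- flat everywhere
        push Not at hneg
        refine ⟨len, ⟨hlen, le_rfl⟩, Or.inl ⟨fun v hv ↦ ?_, fun a ha b hb hab ↦ ?_⟩⟩
        · simp only
          rw [hmax_of_le v (abs_le.2 ⟨hneg v hv, hpos v hv⟩), hmax_of_le 0 (abs_le.2 ⟨hneg 0 ⟨le_rfl, hlen⟩, hpos 0 ⟨le_rfl, hlen⟩⟩)]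
        · exfalso
          have h1 : a = len := le_antisymm ha.2 ha.1
          have h2 : b = len := le_antisymm hb.2 hb.1
          rw [h1, h2] at hab
          exact lt_irrefl _ hab

/-- **The distance to `c₀` along a short horizontal segment far from `c₀`** has the
constant/monotone shape. [folklore] -/
theorem dist_horizontal_shape {c₀ x₀ : ℝ × ℝ} {len R₀ : ℝ} (hlen : 0 ≤ len) (hR : len < R₀)
    (hfar : ∀ u ∈ Icc 0 len, R₀ ≤ dist (x₀ + ((u, 0) : ℝ × ℝ)) c₀) :
    ConstMonoShape (fun u ↦ dist (x₀ + ((u, 0) : ℝ × ℝ)) c₀) len := by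
  have heq : ∀ u, dist (x₀ + ((u, 0) : ℝ × ℝ)) c₀ = max |x₀.1 - c₀.1 + u| |x₀.2 - c₀.2| := fun u ↦ by
    rw [Prod.dist_eq, Real.dist_eq, Real.dist_eq]
    simp only [Prod.fst_add, Prod.snd_add, add_zero]
    congr 1; ring_nf
  simp_rw [heq]
  exact maxAbs_shape (abs_nonneg _) hlen hR fun u hu ↦ by rw [← heq]; exact hfar u hu

/-- **The distance to `c₀` along a short vertical segment far from `c₀`** has the
constant/monotone shape. [folklore] -/
theorem dist_vertical_shape {c₀ x₀ : ℝ × ℝ} {len R₀ : ℝ} (hlen : 0 ≤ len) (hR : len < R₀)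
    (hfar : ∀ u ∈ Icc 0 len, R₀ ≤ dist (x₀ + ((0, u) : ℝ × ℝ)) c₀) :
    ConstMonoShape (fun u ↦ dist (x₀ + ((0, u) : ℝ × ℝ)) c₀) len := by
  have heq : ∀ u, dist (x₀ + ((0, u) : ℝ × ℝ)) c₀ = max |x₀.2 - c₀.2 + u| |x₀.1 - c₀.1| := fun u ↦ by
    rw [Prod.dist_eq, Real.dist_eq, Real.dist_eq, max_comm]
    simp only [Prod.fst_add, Prod.snd_add, add_zero]
    congr 1; ring_nf
  simp_rw [heq]
  exact maxAbs_shape (abs_nonneg _) hlen hR fun u hu ↦ by rw [← heq]; exact hfar u hu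

end CollarRadius

end Literature.Topology.FourManifolds
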